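import Summits.CriticalPhenomena.PercolationContinuityZ3.Theorems.Transplant.SkelCylBall
import HarnessLib

/-!
# L4.6 of the general node (`HOME/SHEAR-SCOPE.md` §3.9, §3.1 row `fibCtr`, §3.5): the RIM / DEEP dichotomy of a contact over a
# root-centred window — WITHOUT retraction: behind a contact `x`, either the route ball of scale `ψℓ` fits in the window
# `B_G(w₀, R)` (deep), or everything within `nF` of `x` lies beyond depth `R − L′` (rim), provided `ψℓ + nF ≤ L′ ≤ R`

builds on p205010 (kernel theorem, internal audit signed; external expert review pending) — nothing in this file uses p205010.
Lane `prim-bschramm`, seat `prim-bschramm-p3` (gen 4); helper file (`--supports stmt-CriticalPhenomena-4575 --as helper`).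
Generic twin of `BoxProdZ2RimDeep` (pure triangle inequality in `(V, d_G)`).  The product retracted the contact's fibre coordinate
towards the window centre (`fibCtrT`) to keep the kit cube inside the window; no such retraction exists generically (a `G`-geodesic
moves `φ`; p1-g7 18:34:54Z, P5 §21), and none is needed for the dichotomy: with `c := x` itself, `x ∈ B(w₀, R − ψℓ)` gives the deep
case and otherwise `B(x, nF) ∩ B(w₀, R − L′) = ∅`.  The rim case is then served by the collar / excess bound (`SkelExcess`,
`SkelConcExcess`): the contact's whole kit region belongs to the rim part of the enlarged target.
* `deep_or_far` (graph balls), `prismAt_deep_or_far` (the kit region `prismAt x nF A`), `cylBall_deep_or_far` (the fat form);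
* `mem_graphBall_of_deep` (in the deep case the route region `prismAt x ψℓ A` lies at depth `≤ R`).
[cite: KozmaNitzan2024, §4 p. 21 (v(P) + Λ_M ⊆ S), Lemma 12 p. 24 (the edge faces of the corridor) — the ℤ^d model has no window]
-/

noncomputable section

namespace Summit.CriticalPhenomena.PercolationContinuityZ3.Theorems

namespace Transplant

namespace Skel

open Literature.Probability.Percolation Literature.Probability.LatticeModels SimpleGraph
open Literature.Probability.Percolation.GM
open Literature.Barriers.CriticalPhenomena (graphBall graphBall_finite mem_graphBall_self graphBall_mono)

variable {V : Type} (G : SimpleGraph V)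

/-- **Deep or far** (no retraction): for radii `ψℓ + nF ≤ L' ≤ R` and any vertex `x`, either `B_G(x, ψℓ) ⊆ B_G(w₀, R)`, or `B_G(x, nF)`
misses `B_G(w₀, R − L')`. [cite: KozmaNitzan2024, §4 p. 21, Lemma 12 p. 24] -/
theorem deep_or_far {w₀ : V} {R nF ψℓ L' : ℕ} (x : V) (hL : ψℓ + nF ≤ L') (hLR : L' ≤ R) :
    graphBall G x ψℓ ⊆ graphBall G w₀ R ∨ Disjoint (graphBall G x nF) (graphBall G w₀ (R - L')) := by
  by_cases hdeep : x ∈ graphBall G w₀ (R - ψℓ)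
  · left
    intro b hb
    exact graphBall_mono G w₀ (by omega) (BoxProdZ2.mem_graphBall_add G hdeep hb)
  · right
    rw [Set.disjoint_left]
    intro b hb hb'
    apply hdeep
    have hxb : x ∈ graphBall G b nF := (BoxProdZ2.mem_graphBall_comm G).1 hb
    exact graphBall_mono G w₀ (by omega) (BoxProdZ2.mem_graphBall_add G hb' hxb)

variable {G} [G.LocallyFinite] (Φ : PlanarSkeletonConc G)

/-- **The kit region behind a contact is deep or far**: either the route region `prismAt x ψℓ A` lies in `B_G(w₀, R)`, or every vertex of
the kit region `prismAt x nF B` lies outside `B_G(w₀, R − L')` (its faces belong to the rim part of the enlarged target).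
[cite: KozmaNitzan2024, §4 p. 21, Lemma 12 p. 24] -/
theorem prismAt_deep_or_far {w₀ : V} {R nF ψℓ L' : ℕ} (x : V) (hL : ψℓ + nF ≤ L') (hLR : L' ≤ R) (A B : Set (Site 2)) :
    Φ.toPlanarSkeleton.prismAt x ψℓ A ⊆ graphBall G w₀ R ∨
      ∀ u ∈ Φ.toPlanarSkeleton.prismAt x nF B, u ∉ graphBall G w₀ (R - L') := by
  rcases deep_or_far G (nF := nF) x hL hLR with h | h
  · exact Or.inl fun u hu => h hu.1
  · exact Or.inr fun u hu hu' => Set.disjoint_left.1 h hu.1 hu'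

/-- The same with the FAT kit region `cylBall x n nF` (a ball of the induced cylinder graph lies in the graph ball of the same radius).
[cite: KozmaNitzan2024, §4 p. 21, Lemma 12 p. 24] -/
theorem cylBall_deep_or_far {w₀ : V} {R nF ψℓ L' : ℕ} (x : V) (hL : ψℓ + nF ≤ L') (hLR : L' ≤ R) (n m : ℕ) :
    Φ.cylBall x m ψℓ ⊆ graphBall G w₀ R ∨ ∀ u ∈ Φ.cylBall x n nF, u ∉ graphBall G w₀ (R - L') := by
  rcases deep_or_far G (nF := nF) x hL hLR with h | h
  · exact Or.inl fun u hu => h (Φ.cylBall_subset_prism x m ψℓ hu).1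
  · exact Or.inr fun u hu hu' => Set.disjoint_left.1 h (Φ.cylBall_subset_prism x n nF hu).1 hu'

omit [G.LocallyFinite] in
/-- In the deep case a point at distance `≤ ψℓ` from the contact has depth `≤ R` (the route region sits inside the window). [folklore] -/
theorem mem_graphBall_of_deep {w₀ x : V} {R ψℓ : ℕ} (h : graphBall G x ψℓ ⊆ graphBall G w₀ R) {u : V} (hu : u ∈ graphBall G x ψℓ) :
    u ∈ graphBall G w₀ R :=
  h hu

omit [G.LocallyFinite] in
/-- A contact at depth `≤ R − ψℓ` is deep. [folklore] -/
theorem deep_of_mem_graphBall {w₀ x : V} {R ψℓ : ℕ} (hx : x ∈ graphBall G w₀ (R - ψℓ)) (hR : ψℓ ≤ R) :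
    graphBall G x ψℓ ⊆ graphBall G w₀ R := fun _ hb =>
  graphBall_mono G w₀ (by omega) (BoxProdZ2.mem_graphBall_add G hx hb)

end Skel

end Transplant

end Summit.CriticalPhenomena.PercolationContinuityZ3.Theorems

end
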